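import Mathlib
import HarnessLib
import Summits.HubbardSuperconductivity.HubbardSuperconductivity.Theorems.KLProgrammeKLRegimeEngineTowerNumerics
import Summits.HubbardSuperconductivity.HubbardSuperconductivity.Theorems.KLProgrammeKLRegimeEngineTowerNumericsRegime

/-!
# Route `KLProgramme` — crux K3 ENGINE (stmt-HubbardSuperconductivity-20437 `KLRegimeEngineV17F2`), stub (b) v2, THE LEVELS PACKAGE (ℓ):
# instantiation (I5), THE NUMERICS — ONE CALL from the two DOORS: `U ≤ u` and `cc ≤ cT` give every λ-dependent side condition of the kit
# (joins `…TowerNumerics` (p635154) and `…TowerNumericsRegime` (p635537) at the package shape of AMENDMENT 23 «(ℓ)-C-SLOT» (`…V8TowerCEDefsC`, p637964):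
#  the tower's package chooses `u := λ₀/(2·B·Klam + 1)` and `cT := λ₀·log 4/(2·B·Klam + 1)`; cell gate-hubbard-kl, seat hubbard-kl-k3c3-p2 g13; located «(ℓ)-NUMERICS»)

With `lam := B · epsCoupling P U j` (the kit's constant coupling at read-out level `j ≤ n`), the regime binder `IsKLRegime U cc (−n)`, the U-door
`U ≤ λ₀/(2BKlam+1)` and the c-door `cc ≤ λ₀·log 4/(2BKlam+1)` — `λ₀` = the seven-entry min-chain of `towerNumerics_side_of_lam_le` — and the two amplitude rows
(N1) (N2), ALL of `hx₁ hx₂ hx₃ hy hθ hclose` of `towerBorn_le_law_split` / `towerBorn_le_law_tracks` hold, and `0 < lam` (the kit's `hlam`) for `0 < U`, `0 < B`, `0 < Klam`: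

* `towerNumerics_lam_le_threshold_of_doors` — `B·ε_j ≤ λ₀` from the two closed-form doors;
* **`towerNumerics_side_of_doors`** — the six side conditions at `lam := B·epsCoupling P U j`.
So (I5)'s `∃ e, IsTowerPkgC e ∧ …` takes `e.2.1 := fun _ _ => λ₀/(2BKlam+1) ⊓ …` and `e.2.2 := λ₀·log 4/(2BKlam+1)` (both positive by `towerNumerics_threshold_pos`),
once (I1)–(I4) name the kit constants.  Pure real arithmetic; nothing about the model is asserted; nothing asserts any stub, (ℓ), K3 or superconductivity.
References: BGM 2006 §2.8 (2.83), §3 [cite: BenfattoGiulianiMastropietro2006].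
-/

noncomputable section

namespace Summit.HubbardSuperconductivity.HubbardSuperconductivity.Theorems.EngineV8

set_option linter.dupNamespace false -- summit = problem name (single-conjunct summit), D-0017

open Real
open Summit.HubbardSuperconductivity.HubbardSuperconductivity.Theorems.KLRegimeSplit
open Summit.HubbardSuperconductivity.HubbardSuperconductivity.Theorems.DispersionFlow

variable {P : SplitConsts} {σ Φ ψ τ A A' Q Q' ι₁ ι₂ ι₃ B U cc : ℝ} {n j : ℕ}

/-- **`B·ε_j ≤ λ₀` from the two closed-form doors** (`λ₀` any nonnegative threshold; here it will be the min-chain). -/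
theorem towerNumerics_lam_le_threshold_of_doors (hK : 0 ≤ P.Klam) (hB : 0 ≤ B) (hU : 0 ≤ U) {lam₀ : ℝ} (hlam₀ : 0 ≤ lam₀)
    (hreg : IsKLRegime U cc (-(n : ℤ))) (hj : j ≤ n)
    (hUdoor : U ≤ lam₀ / (2 * B * P.Klam + 1)) (hcdoor : cc ≤ lam₀ * Real.log 4 / (2 * B * P.Klam + 1)) :
    B * epsCoupling P U j ≤ lam₀ :=
  towerNumerics_lam_le_of_doors hK hU hB hreg hj (towerNumerics_uDoor_of_le hK hB hlam₀ hUdoor) (towerNumerics_cDoor_of_le hK hB hlam₀ hcdoor)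

/-- **ONE CALL FROM THE DOORS — every λ-dependent side condition of the kit at `lam := B·epsCoupling P U j`.**  Hypotheses: nonnegative kit constants with
`0 < A·Q³`; `0 ≤ B`, `0 ≤ U`, `0 ≤ Klam`; the regime binder and `j ≤ n`; the amplitude rows (N1) (N2); the U-door and the c-door at the min-chain threshold `λ₀`. -/
theorem towerNumerics_side_of_doors (hK : 0 ≤ P.Klam) (hσ : 0 ≤ σ) (hΦ : 0 ≤ Φ) (hψ : 0 ≤ ψ) (hτ : 0 ≤ τ) (hA' : 0 ≤ A') (hQ' : 0 ≤ Q')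
    (hι₁ : 0 ≤ ι₁) (hι₂ : 0 ≤ ι₂) (hι₃ : 0 ≤ ι₃) (hAQ : 0 < A * Q ^ 3) (hB : 0 ≤ B) (hU : 0 ≤ U)
    (hreg : IsKLRegime U cc (-(n : ℤ))) (hj : j ≤ n)
    (N1 : Φ * (τ * (ι₂ / (2 * Q') + ι₃ / (4 * Q' ^ 2) + A' * Q' / 4)) ≤ 1 / 4)
    (N2 : 16 * exp 1 * ψ * (2 * τ * ψ * Q') ^ 2 * Φ * τ ^ 2 * (ι₂ / (2 * Q') + ι₃ / (4 * Q' ^ 2) + A' * Q' / 4) ^ 2 ≤ A * Q ^ 3)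
    (hUdoor : U ≤ min 1 (min (1 / (8 * σ * Q' + 1)) (min (1 / (2 * exp 1 * τ * Q' + 1)) (min (1 / (4 * Φ * τ * ι₁ + 1))
      (min (1 / (2 * (Φ * (exp 1 * τ * ι₁ + (exp 1 * τ) ^ 2 * ι₂ + (exp 1 * τ) ^ 3 * ι₃ + A' * (exp 1 * τ * Q') ^ 2 / 2)) + 1))
        (min (A * Q ^ 3 / (16 * σ * Q' * A' * (4 * Q') ^ 3 + A * Q ^ 3))
          (A * Q ^ 3 / (16 * exp 1 * ψ * (2 * τ * ψ * Q') ^ 2 * Φ * τ ^ 2 * ι₁ ^ 2 + A * Q ^ 3))))))) / (2 * B * P.Klam + 1))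
    (hcdoor : cc ≤ min 1 (min (1 / (8 * σ * Q' + 1)) (min (1 / (2 * exp 1 * τ * Q' + 1)) (min (1 / (4 * Φ * τ * ι₁ + 1))
      (min (1 / (2 * (Φ * (exp 1 * τ * ι₁ + (exp 1 * τ) ^ 2 * ι₂ + (exp 1 * τ) ^ 3 * ι₃ + A' * (exp 1 * τ * Q') ^ 2 / 2)) + 1))
        (min (A * Q ^ 3 / (16 * σ * Q' * A' * (4 * Q') ^ 3 + A * Q ^ 3))
          (A * Q ^ 3 / (16 * exp 1 * ψ * (2 * τ * ψ * Q') ^ 2 * Φ * τ ^ 2 * ι₁ ^ 2 + A * Q ^ 3))))))) * Real.log 4 / (2 * B * P.Klam + 1)) :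
    4 * σ * (B * epsCoupling P U j) * Q' < 1 ∧ 2 * (B * epsCoupling P U j) * τ * Q' ≤ 1 ∧ exp 1 * τ * (B * epsCoupling P U j) * Q' < 1 ∧
      Φ * (τ * (ι₁ * (B * epsCoupling P U j) + ι₂ / (2 * Q') + ι₃ / (4 * Q' ^ 2) + A' * Q' / 4)) < 1 ∧
      Φ * (exp 1 * τ * (ι₁ * (B * epsCoupling P U j)) + (exp 1 * τ) ^ 2 * (ι₂ * (B * epsCoupling P U j)) +
        (exp 1 * τ) ^ 3 * (ι₃ * (B * epsCoupling P U j) ^ 2) +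
        A' * (exp 1 * τ * Q') * ((exp 1 * τ * (B * epsCoupling P U j) * Q') ^ 3 / (1 - exp 1 * τ * (B * epsCoupling P U j) * Q'))) < 1 ∧
      A' * (4 * Q') ^ 3 * (4 * σ * (B * epsCoupling P U j) * Q' / (1 - 4 * σ * (B * epsCoupling P U j) * Q')) +
        exp 1 * ψ * (2 * τ * ψ * Q') ^ 2 * (τ * (ι₁ * (B * epsCoupling P U j) + ι₂ / (2 * Q') + ι₃ / (4 * Q' ^ 2) + A' * Q' / 4)) *
          (Φ * (τ * (ι₁ * (B * epsCoupling P U j) + ι₂ / (2 * Q') + ι₃ / (4 * Q' ^ 2) + A' * Q' / 4)) /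
            (1 - Φ * (τ * (ι₁ * (B * epsCoupling P U j) + ι₂ / (2 * Q') + ι₃ / (4 * Q' ^ 2) + A' * Q' / 4)))) ≤ A * Q ^ 3 := by
  have hpos := towerNumerics_threshold_pos (ι₂ := ι₂) (ι₃ := ι₃) hσ hΦ hψ hτ hA' hQ' hι₁ hι₂ hι₃ hAQ
  have hle := towerNumerics_lam_le_threshold_of_doors hK hB hU hpos.le hreg hj hUdoor hcdoor
  have hε0 : 0 ≤ epsCoupling P U j := by unfold epsCoupling; positivity
  have hlam : 0 ≤ B * epsCoupling P U j := mul_nonneg hB hε0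
  exact towerNumerics_side_of_lam_le hσ hΦ hψ hτ hA' hQ' hι₁ hι₂ hι₃ hAQ hlam hle N1 N2

end Summit.HubbardSuperconductivity.HubbardSuperconductivity.Theorems.EngineV8

end
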